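import Literature.AlgebraicGeometry.Resolution.AlterationsDescentLimit2
import Literature.AlgebraicGeometry.Motives.ProjectiveDescentFiniteExtensionProofs
import HarnessLib

/-!
# De Jong 1996, 4.5: the limit argument, III — the boundary, projectivity, and the discharge

Topic: `Literature/AlgebraicGeometry/Resolution`. Conclusion of the discharge of the named fact
`DeJong1996.FiniteSubextension45` (de Jong 1996, 4.5) begun in `AlterationsDescentLimit.lean`
and `AlterationsDescentLimit2.lean`. At the final stage `tf` (`Setup.Ef ⊇ Setup.Uf`,
`Setup.φf : U_f → X'_f`) we prove:

* the boundary `B_f = U_f(φ_f⁻¹ Z'_f) ∪ (E_f ∖ U_f)` pulls back to the strict normal crossings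
  boundary `B̄ ⊆ X̄̄₁` and is a strict normal crossings divisor
  (`StrictNormalCrossingsFlatDescent.lean`, the hypotheses H1/H2 being supplied by the stages
  `iH`, `iM` of part II) — `Setup.isSNC_Bf`;
* `E_f` is projective over `k₁ = k(tf)` (a closed subscheme of `ℙⁿ_{k₁}`; via
  `Motives.isProjectiveOver_of_isAffineHom_of_comp_eq`) — `Setup.isProjectiveOver_Ef`;
* the repackaging of the Spec-first cone-point data to the shape of the fact
  (`pullback f (Spec.map _)`, an `IntermediateField`), whence
  `DeJong1996.FiniteSubextension45_holds` and **`DeJong1996Descent_holds`**.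

## References

* A. J. de Jong, *Smoothness, semi-stability and alterations*, Publ. Math. IHÉS 83 (1996), 4.5.
* U. Görtz, T. Wedhorn, *Algebraic Geometry I* (2020), (10.13), Prop. 10.75, Prop. 14.53.
-/

noncomputable section

universe u

open CategoryTheory CategoryTheory.Limits AlgebraicGeometry TopologicalSpace
  Literature.AlgebraicGeometry.Limits Literature.AlgebraicGeometry.Limits.FieldExt
  Literature.AlgebraicGeometry.Motives Scheme.IdealSheafData

namespace Literature.AlgebraicGeometry.Resolution

namespace DeJong1996.Descent45

set_option backward.isDefEq.respectTransparency false

/-! ## Generalities -/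

section General

variable {X Y : Scheme.{u}}

/-- Pull-back of an ideal sheaf along an isomorphism is push-forward along its inverse.
[folklore] -/
theorem comap_hom_eq_map_inv (e : X ≅ Y) (J : Y.IdealSheafData) :
    J.comap e.hom = J.map e.inv := by
  have h1 : (J.comap e.hom).comap e.inv = J := by
    rw [← comap_comp, Iso.inv_hom_id, comap_id]
  apply le_antisymm
  · rw [le_map_iff_comap_le, h1]
  · apply le_of_comap_le_comap e.inv
    rw [h1]
    exact comap_map_le _ _

/-- For an isomorphism `e : X ≅ Y`, `e '' S = e⁻¹ ⁻¹' S`. [folklore] -/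
theorem image_hom_eq_preimage_inv (e : X ≅ Y) (S : Set X) : e.hom '' S = e.inv ⁻¹' S := by
  have h₁ : Function.LeftInverse e.inv e.hom := fun x => by
    rw [← Scheme.Hom.comp_apply, Iso.hom_inv_id]; rfl
  have h₂ : Function.RightInverse e.inv e.hom := fun y => by
    rw [← Scheme.Hom.comp_apply, Iso.inv_hom_id]; rfl
  exact congrFun (Set.image_eq_preimage_of_inverse h₁ h₂) S

/-- For an isomorphism `e : X ≅ Y`, `e⁻¹ '' S = e ⁻¹' S`. [folklore] -/
theorem image_inv_eq_preimage_hom (e : X ≅ Y) (S : Set Y) : e.inv '' S = e.hom ⁻¹' S :=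
  image_hom_eq_preimage_inv e.symm S

/-- **Pull-back of a vanishing ideal along an isomorphism** is the vanishing ideal of the
preimage. [folklore] -/
theorem comap_vanishingIdeal_iso (e : X ≅ Y) (Z : Closeds Y) :
    (vanishingIdeal Z).comap e.hom = vanishingIdeal ⟨e.hom ⁻¹' Z, Z.isClosed.preimage e.hom.continuous⟩ := by
  rw [comap_hom_eq_map_inv, map_vanishingIdeal]
  congr 1
  apply Closeds.ext
  change closure (e.inv '' (Z : Set Y)) = e.hom ⁻¹' Z
  rw [image_inv_eq_preimage_hom, (Z.isClosed.preimage e.hom.continuous).closure_eq]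

/-- An isomorphism maps maximal points of `e ⁻¹' C` to maximal points of `C`. [folklore] -/
theorem maxPts_preimage_iso (e : X ≅ Y) (C : Set Y) {η : X} (hη : η ∈ Setup.maxPts (e.hom ⁻¹' C)) :
    e.hom η ∈ Setup.maxPts C := by
  refine ⟨hη.1, fun η' hη' hsp => ?_⟩
  have h1 : e.inv η' ∈ e.hom ⁻¹' C := by
    change e.hom (e.inv η') ∈ C
    rw [← Scheme.Hom.comp_apply, Iso.inv_hom_id]; exact hη'
  have h2 : e.inv η' ⤳ η := by
    have := hsp.map e.inv.continuous
    rwa [← Scheme.Hom.comp_apply, Iso.hom_inv_id] at this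
  have h3 := hη.2 _ h1 h2
  rw [← h3, ← Scheme.Hom.comp_apply, Iso.inv_hom_id]; rfl

/-- The preimage under an isomorphism of the closure of a point. [folklore] -/
theorem preimage_closure_singleton_iso (e : X ≅ Y) (η : X) :
    e.hom ⁻¹' closure {e.hom η} = closure {η} := by
  have h1 : e.hom ⁻¹' closure {e.hom η} = closure (e.hom ⁻¹' {e.hom η}) :=
    (Scheme.homeoOfIso e).preimage_closure _
  rw [h1]
  congr 1
  ext x
  simp only [Set.mem_preimage, Set.mem_singleton_iff]
  constructor
  · intro h
    have := congrArg e.inv h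
    rwa [← Scheme.Hom.comp_apply, ← Scheme.Hom.comp_apply, Iso.hom_inv_id] at this
  · rintro rfl; rfl

/-- A homeomorphism maps irreducible components to irreducible components. [folklore] -/
theorem image_mem_irreducibleComponents_of_homeomorph {α β : Type u} [TopologicalSpace α]
    [TopologicalSpace β] (h : α ≃ₜ β) {C : Set α} (hC : C ∈ irreducibleComponents α) :
    h '' C ∈ irreducibleComponents β := by
  refine ⟨hC.1.image h h.continuous.continuousOn, fun t ht hle => ?_⟩
  have h1 : IsIrreducible (h.symm '' t) := ht.image h.symm h.symm.continuous.continuousOn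
  have h2 : C ⊆ h.symm '' t := by
    intro x hx
    exact ⟨h x, hle ⟨x, hx, rfl⟩, h.symm_apply_apply x⟩
  have h3 := hC.2 h1 h2
  intro y hy
  obtain ⟨x, hx, rfl⟩ : y ∈ h '' (h.symm '' t) := ⟨h.symm y, ⟨y, hy, rfl⟩, h.apply_symm_apply y⟩
  exact ⟨x, h3 hx, rfl⟩

end General

namespace Setup

variable {k K : Type u} [Field k] [Field K] [Algebra k K] (S : Setup k K)

/-! ## The boundary at the final stage -/

/-- The projection `X'_f → X'₀ → X₀ → X`. [folklore] -/
def πX : S.Xf ⟶ S.X :=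
  pullback.snd (Spec.map ((stageNat k K S.t₀).app S.tf.unop)) S.qX₀ ≫ S.X'₀ι ≫
    pullback.snd (Spec.map ((baseNat k K ∅).app S.s₀.unop)) S.f

/-- `X̄' → X'_f → X` is `X̄' ↪ X_K → X`. [folklore] -/
theorem legXf_πX : S.legXf ≫ S.πX = S.ιb ≫ pullback.snd (Spec.map (σ₁ k K)) S.f := by
  have h1 : S.toX'₀ ≫ S.X'₀ι = S.ιb' ≫ S.legX S.s₀ := Scheme.Hom.toImage_imageι _
  have h2 : S.legX S.s₀ ≫ pullback.snd (Spec.map ((baseNat k K ∅).app S.s₀.unop)) S.f =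
      pullback.snd (Spec.map (σ₁ k K)) S.f :=
    schemeCone_π_app_snd k K ∅ (.of k) (baseNat k K ∅) (σ₁ k K) (baseNat_ι k K ∅) S.XO S.s₀
  rw [πX, ← Category.assoc, S.legXf_snd, ← Category.assoc, h1, Category.assoc]
  exact congrArg (S.ιb ≫ ·) h2

/-- `Z'_f ⊆ X'_f`, the preimage of `Z`. [folklore] -/
def Zf : Set S.Xf := S.πX ⁻¹' S.Z

/-- The preimage of `Z` in `X̄'`. [folklore] -/
abbrev Zb : Set S.Xb := (S.ιb ≫ pullback.snd (Spec.map (σ₁ k K)) S.f) ⁻¹' S.Z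

/-- `Z'_f` pulls back to `Z̄'`. [folklore] -/
theorem preimage_Zf : S.legXf ⁻¹' S.Zf = S.Zb := by
  ext x
  change S.πX (S.legXf x) ∈ S.Z ↔ (S.ιb ≫ pullback.snd (Spec.map (σ₁ k K)) S.f) x ∈ S.Z
  rw [← Scheme.Hom.comp_apply, S.legXf_πX]

/-- **The boundary at the final stage** `B_f = U_f(φ_f⁻¹ Z'_f) ∪ (E_f ∖ U_f)`. [cite: DeJong1996, 4.5, p. 66] -/
def Bf : Set S.Ef := S.Uf.ι '' (S.φf ⁻¹' S.Zf) ∪ (Set.range S.Uf.ι)ᶜ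

/-- `Z'_f` is closed. [folklore] -/
theorem isClosed_Zf : IsClosed S.Zf := S.isClosed_Z.preimage S.πX.continuous

/-- `B_f` is closed: its complement is the image of the open `U_f ∖ φ_f⁻¹ Z'_f` under the open
immersion `U_f ↪ E_f`. [folklore] -/
theorem isClosed_Bf : IsClosed S.Bf := by
  have h1 : S.Bfᶜ = S.Uf.ι '' (S.φf ⁻¹' S.Zf)ᶜ := by
    ext y
    constructor
    · intro hy
      have hy' : y ∈ Set.range S.Uf.ι := by
        by_contra h
        exact hy (Or.inr h)
      obtain ⟨u, rfl⟩ := hy'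
      exact ⟨u, fun hu => hy (Or.inl ⟨u, hu, rfl⟩), rfl⟩
    · rintro ⟨u, hu, rfl⟩ hy
      rcases hy with ⟨u', hu', he⟩ | h
      · exact hu (S.Uf.ι.isOpenEmbedding.injective he ▸ hu')
      · exact h ⟨u, rfl⟩
  rw [← isOpen_compl_iff, h1]
  exact S.Uf.ι.isOpenEmbedding.isOpenMap _
    ((S.isClosed_Zf.preimage S.φf.continuous).isOpen_compl)

/-- Points: `U_f.ι ((legE ∣ U_f) x) = legE x`. [folklore] -/
theorem ι_restrict_apply (x : (S.legEf ⁻¹ᵁ S.Uf : S.Xbar₁.Opens)) :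
    S.Uf.ι ((S.legEf ∣_ S.Uf) x) = S.legEf x.1 := by
  rw [← Scheme.Hom.comp_apply, morphismRestrict_ι, Scheme.Hom.comp_apply]
  rfl

/-- Points: `j₁ (Θ x) = x`. [folklore] -/
theorem j₁_Θ_apply (x : (S.legEf ⁻¹ᵁ S.Uf : S.Xbar₁.Opens)) : S.j₁ (S.Θ.hom x) = x.1 := by
  rw [← Scheme.Hom.comp_apply, S.Θ_hom_j₁]
  rfl

variable [Algebra.IsAlgebraic k K]

omit [Algebra.IsAlgebraic k K] in
/-- Points: `πX (φ_f ((legE ∣ U_f) x)) = (X̄' → X) (φ₁ (Θ x))`. [folklore] -/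
theorem πX_φf_restrict_apply (x : (S.legEf ⁻¹ᵁ S.Uf : S.Xbar₁.Opens)) :
    S.πX (S.φf ((S.legEf ∣_ S.Uf) x)) =
      (S.ιb ≫ pullback.snd (Spec.map (σ₁ k K)) S.f) (S.φ₁ (S.Θ.hom x)) := by
  have h1 : (S.legEf ∣_ S.Uf) ≫ S.φf ≫ S.πX = S.φ₁' ≫ S.legXf ≫ S.πX := by
    rw [← Category.assoc, ← S.φ₁'_legXf, Category.assoc]
  have h2 := congrArg (fun φ : (S.legEf ⁻¹ᵁ S.Uf : Scheme.{u}) ⟶ S.X => φ x) h1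
  simp only [Scheme.Hom.comp_apply] at h2
  rw [h2, ← Scheme.Hom.comp_apply S.legXf, S.legXf_πX]

omit [Algebra.IsAlgebraic k K] in
/-- Membership in `legE⁻¹ U_f` is membership in `j₁(X₁)`. [folklore] -/
theorem mem_preimage_Uf_iff (x : S.Xbar₁) : x ∈ S.legEf ⁻¹ᵁ S.Uf ↔ x ∈ Set.range S.j₁ := by
  rw [S.preimage_Uf]; rfl

omit [Algebra.IsAlgebraic k K] in
/-- **The boundary pulls back to `B̄`**: `legE⁻¹ B_f = B̄`. [cite: DeJong1996, 4.5, p. 66] -/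
theorem preimage_Bf : S.legEf ⁻¹' S.Bf = S.Bbar := by
  ext x
  constructor
  · intro hx
    rcases hx with ⟨u, hu, he⟩ | hx
    · left
      have hxU : x ∈ S.legEf ⁻¹ᵁ S.Uf := by
        rw [Scheme.Hom.mem_preimage, ← he]
        exact u.2
      have hu' : (S.legEf ∣_ S.Uf) ⟨x, hxU⟩ = u :=
        S.Uf.ι.isOpenEmbedding.injective ((S.ι_restrict_apply ⟨x, hxU⟩).trans he.symm)
      refine ⟨S.Θ.hom ⟨x, hxU⟩, ?_, S.j₁_Θ_apply ⟨x, hxU⟩⟩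
      change (S.ιb ≫ pullback.snd (Spec.map (σ₁ k K)) S.f) (S.φ₁ (S.Θ.hom ⟨x, hxU⟩)) ∈ S.Z
      rw [← S.πX_φf_restrict_apply, hu']
      exact hu
    · right
      rintro ⟨y, hy⟩
      apply hx
      have hxU : x ∈ S.legEf ⁻¹ᵁ S.Uf := (S.mem_preimage_Uf_iff x).mpr ⟨y, hy⟩
      exact ⟨(S.legEf ∣_ S.Uf) ⟨x, hxU⟩, S.ι_restrict_apply ⟨x, hxU⟩⟩
  · intro hx
    rcases hx with ⟨y, hy, rfl⟩ | hx
    · left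
      have hxU : S.j₁ y ∈ S.legEf ⁻¹ᵁ S.Uf := (S.mem_preimage_Uf_iff _).mpr ⟨y, rfl⟩
      have hΘ : S.Θ.hom ⟨S.j₁ y, hxU⟩ = y :=
        S.j₁.isOpenEmbedding.injective (S.j₁_Θ_apply ⟨S.j₁ y, hxU⟩)
      refine ⟨(S.legEf ∣_ S.Uf) ⟨S.j₁ y, hxU⟩, ?_, S.ι_restrict_apply ⟨S.j₁ y, hxU⟩⟩
      change S.πX (S.φf ((S.legEf ∣_ S.Uf) ⟨S.j₁ y, hxU⟩)) ∈ S.Z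
      rw [S.πX_φf_restrict_apply, hΘ]
      exact hy
    · right
      rintro ⟨u, hu⟩
      apply hx
      have hxU : x ∈ S.legEf ⁻¹ᵁ S.Uf := by
        rw [Scheme.Hom.mem_preimage, ← hu]
        exact u.2
      exact (S.mem_preimage_Uf_iff x).mp hxU

omit [Algebra.IsAlgebraic k K] in
/-- `legE⁻¹ B_f = e₁⁻¹(B̄ ⊆ E_K)`-form of `preimage_Bf`. [folklore] -/
theorem preimage_Bf_eq : S.legEf ⁻¹' S.Bf = S.e₁.hom ⁻¹' (S.BbarK : Set S.cE.pt) := by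
  rw [S.preimage_Bf]
  ext x
  change x ∈ S.Bbar ↔ S.e₁.inv (S.e₁.hom x) ∈ S.Bbar
  rw [← Scheme.Hom.comp_apply, Iso.hom_inv_id]
  rfl

omit [Algebra.IsAlgebraic k K] in
/-- `B̄ ⊆ E_K` is the preimage of `B_f` under the cone leg. [folklore] -/
theorem BbarK_eq : (S.BbarK : Set S.cE.pt) = S.leg S.tf ⁻¹' S.Bf := by
  ext y
  have h1 : S.e₁.inv y ∈ S.legEf ⁻¹' S.Bf ↔ S.e₁.inv y ∈ S.e₁.hom ⁻¹' (S.BbarK : Set S.cE.pt) := by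
    rw [S.preimage_Bf_eq]
  have h2 : S.e₁.hom (S.e₁.inv y) = y := by
    rw [← Scheme.Hom.comp_apply, Iso.inv_hom_id]; rfl
  have h3 : S.legEf (S.e₁.inv y) = S.leg S.tf y := by
    rw [S.legEf_eq, Scheme.Hom.comp_apply, h2]
  simp only [Set.mem_preimage, h2, h3] at h1
  exact h1.symm

/-- `leg '' B̄ = B_f` (the leg is surjective). [folklore] -/
theorem image_BbarK : S.leg S.tf '' (S.BbarK : Set S.cE.pt) = S.Bf := by
  haveI : Surjective (S.leg S.tf) :=
    surjective_π k K S.t₀ S.k₀ (stageNat k K S.t₀) S.σ₂ (stageNat_ι k K S.t₀) S.EO S.tf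
  rw [S.BbarK_eq, Set.image_preimage_eq _ (S.leg S.tf).surjective]

/-- **H1**: the reduced structure of `B̄` is the pull-back of that of `B_f`. [folklore] -/
theorem H1 : vanishingIdeal ⟨S.legEf ⁻¹' S.Bf, S.isClosed_Bf.preimage S.legEf.continuous⟩ =
    (vanishingIdeal ⟨S.Bf, S.isClosed_Bf⟩).comap S.legEf := by
  -- on `E_K`: `I(B_f).comap leg = I(B̄)` by the choice of the stage `iH`
  have h1 := S.iH_spec S.tf S.tfH
  have h2 : (vanishingIdeal S.BbarK).map (S.leg S.tf) = vanishingIdeal ⟨S.Bf, S.isClosed_Bf⟩ := by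
    rw [map_vanishingIdeal]
    congr 1
    apply Closeds.ext
    change closure (S.leg S.tf '' (S.BbarK : Set S.cE.pt)) = S.Bf
    rw [S.image_BbarK, S.isClosed_Bf.closure_eq]
  rw [h2] at h1
  -- transport along `e₁`
  have h3 : (vanishingIdeal ⟨S.Bf, S.isClosed_Bf⟩).comap S.legEf =
      vanishingIdeal ⟨S.e₁.hom ⁻¹' (S.BbarK : Set S.cE.pt),
        S.BbarK.isClosed.preimage S.e₁.hom.continuous⟩ := by
    rw [S.legEf_eq, comap_comp, h1, comap_vanishingIdeal_iso]
  rw [h3]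
  congr 1
  exact Closeds.ext S.preimage_Bf_eq

omit [Algebra.IsAlgebraic k K] in
/-- **H2**: the reduced structures of the irreducible components of `B̄` are pull-backs.
[folklore] -/
theorem H2 (η : S.Xbar₁) (hη : η ∈ S.legEf ⁻¹' S.Bf)
    (hmax : ∀ η' ∈ S.legEf ⁻¹' S.Bf, η' ⤳ η → η' = η) :
    ∃ 𝒥 : S.Ef.IdealSheafData,
      vanishingIdeal ⟨closure {η}, isClosed_closure⟩ = 𝒥.comap S.legEf := by
  -- `e₁ η` is a maximal point of `B̄ ⊆ E_K`
  have hpre := S.preimage_Bf_eq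
  have hη' : S.e₁.hom η ∈ maxPts (S.BbarK : Set S.cE.pt) :=
    maxPts_preimage_iso S.e₁ _ ⟨hpre ▸ hη, fun η' h' hs => hmax η' (hpre ▸ h') hs⟩
  have h1 := S.iM_spec hη' S.tf S.tfM
  refine ⟨(vanishingIdeal ⟨closure {S.e₁.hom η}, isClosed_closure⟩).map (S.leg S.tf), ?_⟩
  rw [S.legEf_eq, comap_comp, h1, comap_vanishingIdeal_iso]
  congr 1
  apply Closeds.ext
  exact (preimage_closure_singleton_iso S.e₁ η).symm

/-- **The boundary `B_f` is a strict normal crossings divisor in `E_f`.** [cite: DeJong1996, 4.5, p. 66] -/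
theorem isSNC_Bf : IsStrictNormalCrossingsDivisor S.Ef S.Bf := by
  refine IsStrictNormalCrossingsDivisor.of_preimage S.legEf S.isClosed_Bf ?_ S.H1 S.H2
  rw [S.preimage_Bf]
  exact S.isSNC

/-! ## The finite extension `k₁ = k(tf)` as an intermediate field, and projectivity -/

omit [Algebra.IsAlgebraic k K] in
/-- The elements of `K` are algebraic over `k`. [folklore] -/
theorem isAlgebraic_mem [Algebra.IsAlgebraic k K] (t : Finset K) :
    ∀ x ∈ (t : Set K), IsAlgebraic k x := fun x _ => Algebra.IsAlgebraic.isAlgebraic x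

/-- **The finite extension `k₁ = k(tf) ⊆ K`** of de Jong 4.5, as an intermediate field.
[cite: DeJong1996, 4.5, p. 66] -/
def K₁ : IntermediateField k K := IntermediateField.adjoin k (S.tf.unop.1 : Set K)

/-- `k₁` is finite over `k`. [folklore] -/
instance finiteDimensional_K₁ : FiniteDimensional k S.K₁ :=
  IntermediateField.finiteDimensional_adjoin fun x _ => (Algebra.IsAlgebraic.isAlgebraic x).isIntegral

/-- `k₁ = k[tf]` as subalgebras. [folklore] -/
theorem K₁_toSubalgebra : S.K₁.toSubalgebra = fld k K S.tf.unop.1 :=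
  IntermediateField.adjoin_toSubalgebra_of_isAlgebraic (isAlgebraic_mem S.tf.unop.1)

/-- Membership in `k₁` is membership in `k[tf]`. [folklore] -/
theorem mem_K₁_iff (x : K) : x ∈ S.K₁ ↔ x ∈ fld k K S.tf.unop.1 := by
  rw [← IntermediateField.mem_toSubalgebra, S.K₁_toSubalgebra]

/-- The ring isomorphism `k₁ ≃ k[tf]` (the identity on elements of `K`). [folklore] -/
def eK : S.K₁ ≃+* fld k K S.tf.unop.1 where
  toFun x := ⟨x.1, (S.mem_K₁_iff x.1).mp x.2⟩
  invFun x := ⟨x.1, (S.mem_K₁_iff x.1).mpr x.2⟩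
  left_inv _ := rfl
  right_inv _ := rfl
  map_mul' _ _ := rfl
  map_add' _ _ := rfl

/-- `eK` is compatible with the structure maps from `k`. [folklore] -/
theorem eK_algebraMap (a : k) : S.eK (algebraMap k S.K₁ a) = algebraMap k (fld k K S.tf.unop.1) a :=
  Subtype.ext rfl

/-- `eK` is compatible with the inclusions into `K`. [folklore] -/
theorem σf_eK (x : S.K₁) : S.σf (S.eK x) = algebraMap S.K₁ K x := rfl

/-- `Spec k[tf] ≅ Spec k₁`. [folklore] -/
abbrev sE : Spec S.kf ⟶ Spec (CommRingCat.of S.K₁) := Spec.map (CommRingCat.ofHom S.eK.toRingHom)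

/-- `sE` is an isomorphism. [folklore] -/
instance isIso_sE : IsIso S.sE := by
  change IsIso (Scheme.Spec.map (CommRingCat.ofHom S.eK.toRingHom).op)
  haveI : IsIso (CommRingCat.ofHom S.eK.toRingHom) :=
    (inferInstance : IsIso S.eK.toCommRingCatIso.hom)
  infer_instance

/-- The structure morphism `g_f : E_f → Spec k₁`. [folklore] -/
def gE : S.Ef ⟶ Spec (CommRingCat.of S.K₁) := S.qE S.tf ≫ S.sE

/-- The ring map `k₀ → k(tf)` of the level-two diagram. [folklore] -/
abbrev ρf : S.k₀ ⟶ S.kf := (stageNat k K S.t₀).app S.tf.unop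

/-- The ring map `k → k₀` of the level-one diagram. [folklore] -/
abbrev b₀ : CommRingCat.of k ⟶ S.k₀ := (baseNat k K ∅).app S.s₀.unop

/-- The structure map `k → k₁` in `CommRingCat`. [folklore] -/
abbrev aK : CommRingCat.of k ⟶ CommRingCat.of S.K₁ := CommRingCat.ofHom (algebraMap k S.K₁)

/-- `k → k₁ ≅ k[tf]` is `k → k₀ ⊆ k[tf]`. [folklore] -/
theorem aK_eK : S.aK ≫ CommRingCat.ofHom S.eK.toRingHom = S.b₀ ≫ S.ρf :=
  CommRingCat.hom_ext (RingHom.ext fun _ => rfl)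

/-- On spectra: `Spec k[tf] ≅ Spec k₁ → Spec k` is `Spec k[tf] → Spec k₀ → Spec k`. [folklore] -/
@[reassoc]
theorem sE_aK : S.sE ≫ Spec.map S.aK = Spec.map ((stageNat k K S.t₀).app S.tf.unop) ≫ Spec.map ((baseNat k K ∅).app S.s₀.unop) := by
  rw [← Spec.map_comp, ← Spec.map_comp, S.aK_eK]

/-- The affine morphism `r : E_f → X̄̄₀ ↪ P₀ → ℙⁿ_k`. [folklore] -/
def rP : S.Ef ⟶ (projectiveSpace S.n k).left :=
  pullback.snd (Spec.map ((stageNat k K S.t₀).app S.tf.unop)) S.q₀ ≫ S.Xbar₀ι ≫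
    pullback.snd (Spec.map ((baseNat k K ∅).app S.s₀.unop)) (projectiveSpace S.n k).hom

/-- `rP` is affine. [folklore] -/
instance isAffineHom_rP : IsAffineHom S.rP := by
  haveI h1 : IsAffineHom (pullback.snd (Spec.map ((stageNat k K S.t₀).app S.tf.unop)) S.q₀) :=
    MorphismProperty.pullback_snd _ _ inferInstance
  haveI h2 : IsAffineHom (pullback.snd (Spec.map ((baseNat k K ∅).app S.s₀.unop))
      (projectiveSpace S.n k).hom) :=
    MorphismProperty.pullback_snd _ _ inferInstance
  unfold rP
  infer_instance

/-- `rP` is compatible with the structure maps: `rP ≫ (ℙⁿ_k → Spec k) = g_f ≫ (Spec k₁ → Spec k)`.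
[folklore] -/
theorem rP_w : S.rP ≫ (projectiveSpace S.n k).hom = S.gE ≫ Spec.map S.aK := by
  have h1 : pullback.snd (Spec.map ((baseNat k K ∅).app S.s₀.unop)) (projectiveSpace S.n k).hom ≫
      (projectiveSpace S.n k).hom =
      pullback.fst (Spec.map ((baseNat k K ∅).app S.s₀.unop)) (projectiveSpace S.n k).hom ≫
        Spec.map ((baseNat k K ∅).app S.s₀.unop) :=
    (pullback.condition (f := Spec.map ((baseNat k K ∅).app S.s₀.unop))
      (g := (projectiveSpace S.n k).hom)).symm
  have h2 : pullback.snd (Spec.map ((stageNat k K S.t₀).app S.tf.unop)) S.q₀ ≫ (S.Xbar₀ι ≫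
      pullback.fst (Spec.map ((baseNat k K ∅).app S.s₀.unop)) (projectiveSpace S.n k).hom) =
      S.qE S.tf ≫ Spec.map ((stageNat k K S.t₀).app S.tf.unop) :=
    (pullback.condition (f := Spec.map ((stageNat k K S.t₀).app S.tf.unop)) (g := S.q₀)).symm
  calc S.rP ≫ (projectiveSpace S.n k).hom
      = pullback.snd (Spec.map ((stageNat k K S.t₀).app S.tf.unop)) S.q₀ ≫ S.Xbar₀ι ≫
          (pullback.snd (Spec.map ((baseNat k K ∅).app S.s₀.unop)) (projectiveSpace S.n k).hom ≫
            (projectiveSpace S.n k).hom) := by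
        simp only [rP, Category.assoc]
    _ = pullback.snd (Spec.map ((stageNat k K S.t₀).app S.tf.unop)) S.q₀ ≫ S.Xbar₀ι ≫
          (pullback.fst (Spec.map ((baseNat k K ∅).app S.s₀.unop)) (projectiveSpace S.n k).hom ≫
            Spec.map ((baseNat k K ∅).app S.s₀.unop)) := by rw [h1]
    _ = (pullback.snd (Spec.map ((stageNat k K S.t₀).app S.tf.unop)) S.q₀ ≫ (S.Xbar₀ι ≫
          pullback.fst (Spec.map ((baseNat k K ∅).app S.s₀.unop)) (projectiveSpace S.n k).hom)) ≫
            Spec.map ((baseNat k K ∅).app S.s₀.unop) := by simp only [Category.assoc]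
    _ = (S.qE S.tf ≫ Spec.map ((stageNat k K S.t₀).app S.tf.unop)) ≫
          Spec.map ((baseNat k K ∅).app S.s₀.unop) := by rw [h2]
    _ = S.qE S.tf ≫ (S.sE ≫ Spec.map S.aK) := by rw [S.sE_aK, Category.assoc]
    _ = S.gE ≫ Spec.map S.aK := by rw [gE, Category.assoc]

/-- `E_f → Spec k(tf)` is proper. [folklore] -/
instance isProper_qE : IsProper (S.qE S.tf) := by
  change IsProper (pullback.fst (Spec.map ((stageNat k K S.t₀).app S.tf.unop)) S.q₀)
  infer_instance

/-- `g_f` is proper. [folklore] -/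
instance isProper_gE : IsProper S.gE := by
  unfold gE
  infer_instance

/-- **`E_f` is projective over `k₁`** (a closed subscheme of `ℙⁿ_{k₁} = ℙⁿ_k ⊗_k k₁`).
[cite: DeJong1996, 4.5, p. 66] -/
theorem isProjectiveOver_Ef : IsProjectiveOver (Over.mk S.gE : SchemeOver S.K₁) :=
  haveI : IsProper (Over.mk S.gE : SchemeOver S.K₁).hom := S.isProper_gE
  FiniteExtension.isProjectiveOver_of_isAffineHom_of_comp_eq (Over.mk S.gE) S.rP S.rP_w

/-! ## `X'_f` is an irreducible component of `X ⊗_k k(tf)` -/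

/-- Along a flat morphism, the closure of the image of (the generic point of) an irreducible
component is an irreducible component (flat ⇒ generalizing). [folklore] -/
theorem closure_mem_irreducibleComponents_of_flat {Y T : Scheme.{u}} (p : Y ⟶ T) [Flat p]
    {C : Set Y} (hC : C ∈ irreducibleComponents (Y : Type u)) {c : Y} (hc : IsGenericPoint c C) :
    closure {p c} ∈ irreducibleComponents (T : Type u) := by
  refine ⟨isIrreducible_singleton.closure, fun t ht hle => ?_⟩
  have hgen := Flat.generalizingMap p
  let τ := ht.closure.genericPoint
  have hτ : IsGenericPoint τ (closure t) := by
    have := ht.closure.isGenericPoint_genericPoint_closure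
    rwa [closure_closure] at this
  have h1 : p c ∈ closure t := subset_closure (hle (subset_closure (Set.mem_singleton _)))
  have h2 : τ ⤳ p c := hτ.specializes h1
  obtain ⟨c', hc'c, hc'τ⟩ := hgen h2
  have h3 : C ⊆ closure ({c'} : Set Y) := by
    rw [← hc.def]
    exact closure_minimal (Set.singleton_subset_iff.mpr (specializes_iff_mem_closure.mp hc'c))
      isClosed_closure
  have h4 : closure ({c'} : Set Y) ⊆ C := hC.2 isIrreducible_singleton.closure h3
  have h5 : c' ∈ C := h4 (subset_closure (Set.mem_singleton c'))
  have h6 : c ⤳ c' := hc.specializes h5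
  have h7 : c' = c := (hc'c.antisymm h6).eq
  have h8 : τ = p c := by rw [← hc'τ, h7]
  calc t ⊆ closure t := subset_closure
    _ = closure {τ} := hτ.def.symm
    _ = closure {p c} := by rw [h8]

/-- The final stage as an index of the level-one diagrams. [folklore] -/
def tf₁ : (Idx K (∅ : Finset K))ᵒᵖ := Opposite.op ⟨S.tf.unop.1, Finset.empty_subset _⟩

/-- `X_{tf} = Spec k(tf) ×_k X`, an object of the level-one diagram of `X`. [folklore] -/
abbrev XT : Scheme.{u} := (D₁ k K ∅ S.XO).obj S.tf₁

omit [Algebra.IsAlgebraic k K] in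
/-- `Spec k(tf) → Spec k₀ → Spec k` is the level-one structure map at `tf`. [folklore] -/
theorem ρf_b₀ : Spec.map ((stageNat k K S.t₀).app S.tf.unop) ≫ Spec.map ((baseNat k K ∅).app S.s₀.unop) = Spec.map ((baseNat k K ∅).app S.tf₁.unop) := by
  rw [← Spec.map_comp]
  exact congrArg Spec.map (CommRingCat.hom_ext (RingHom.ext fun _ => rfl))

/-- `X'_f ≅ (X_{tf-over-k₀}) ×_{X₀} X'₀`. [folklore] -/
def i1 : pullback (pullback.snd (Spec.map ((stageNat k K S.t₀).app S.tf.unop)) (pullback.fst (Spec.map ((baseNat k K ∅).app S.s₀.unop)) S.f)) S.X'₀ι ≅ S.Xf :=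
  pullbackLeftPullbackSndIso (Spec.map ((stageNat k K S.t₀).app S.tf.unop)) (pullback.fst (Spec.map ((baseNat k K ∅).app S.s₀.unop)) S.f) S.X'₀ι

/-- `Spec k(tf) ×_{k₀} X₀ ≅ X_{tf}`. [folklore] -/
def i2 : pullback (Spec.map ((stageNat k K S.t₀).app S.tf.unop)) (pullback.fst (Spec.map ((baseNat k K ∅).app S.s₀.unop)) S.f) ≅ S.XT :=
  pullbackRightPullbackFstIso (Spec.map ((baseNat k K ∅).app S.s₀.unop)) S.f (Spec.map ((stageNat k K S.t₀).app S.tf.unop)) ≪≫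
    pullback.congrHom S.ρf_b₀ rfl

/-- **The closed immersion `X'_f ↪ X_{tf}`.** [folklore] -/
def cT : S.Xf ⟶ S.XT :=
  S.i1.inv ≫ pullback.fst (pullback.snd (Spec.map ((stageNat k K S.t₀).app S.tf.unop)) (pullback.fst (Spec.map ((baseNat k K ∅).app S.s₀.unop)) S.f)) S.X'₀ι ≫
    S.i2.hom

/-- `cT` is a closed immersion. [folklore] -/
instance isClosedImmersion_cT : IsClosedImmersion S.cT := by
  unfold cT
  infer_instance

omit [Algebra.IsAlgebraic k K] in
/-- `cT` over `Spec k(tf)`. [folklore] -/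
@[reassoc]
theorem cT_fst : S.cT ≫ pullback.fst ((Spec.map ((baseNat k K ∅).app S.tf₁.unop))) S.f = S.qX S.tf := by
  simp only [cT, i1, i2, Iso.trans_hom, Category.assoc, pullback.congrHom_hom,
    pullback.lift_fst, Category.comp_id, pullbackRightPullbackFstIso_hom_fst,
    pullbackLeftPullbackSndIso_inv_fst]

omit [Algebra.IsAlgebraic k K] in
/-- `cT` over `X`. [folklore] -/
@[reassoc]
theorem cT_snd : S.cT ≫ pullback.snd ((Spec.map ((baseNat k K ∅).app S.tf₁.unop))) S.f = S.πX := by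
  simp only [cT, i1, i2, πX, Iso.trans_hom, Category.assoc, pullback.congrHom_hom,
    pullback.lift_snd, Category.comp_id, pullbackRightPullbackFstIso_hom_snd,
    pullbackLeftPullbackSndIso_inv_fst_snd_assoc]

omit [Algebra.IsAlgebraic k K] in
/-- **`X̄' → X'_f ↪ X_{tf}` is `X̄' ↪ X_K → X_{tf}`.** [folklore] -/
theorem legXf_cT : S.legXf ≫ S.cT = S.ιb' ≫ S.legX S.tf₁ := by
  have hF : S.legX S.tf₁ ≫ pullback.fst (Spec.map ((baseNat k K ∅).app S.tf₁.unop)) S.f =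
      pullback.fst (Spec.map (σ₁ k K)) S.f ≫ Spec.map ((ringCocone k K ∅).ι.app S.tf₁.unop) :=
    schemeCone_π_app_fst k K ∅ (.of k) (baseNat k K ∅) (σ₁ k K) (baseNat_ι k K ∅) S.XO S.tf₁
  have hS : S.legX S.tf₁ ≫ pullback.snd (Spec.map ((baseNat k K ∅).app S.tf₁.unop)) S.f =
      pullback.snd (Spec.map (σ₁ k K)) S.f :=
    schemeCone_π_app_snd k K ∅ (.of k) (baseNat k K ∅) (σ₁ k K) (baseNat_ι k K ∅) S.XO S.tf₁
  have hσ : Spec.map (CommRingCat.ofHom S.σf) = Spec.map ((ringCocone k K ∅).ι.app S.tf₁.unop) := rfl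
  apply pullback.hom_ext
  · calc (S.legXf ≫ S.cT) ≫ pullback.fst _ _ = S.legXf ≫ (S.cT ≫ pullback.fst _ _) :=
          Category.assoc _ _ _
      _ = S.legXf ≫ S.qX S.tf := congrArg (S.legXf ≫ ·) S.cT_fst
      _ = S.gb ≫ Spec.map (CommRingCat.ofHom S.σf) := S.hXf.w
      _ = S.ιb ≫ pullback.fst (Spec.map (σ₁ k K)) S.f ≫
            Spec.map ((ringCocone k K ∅).ι.app S.tf₁.unop) := by rw [hσ, Category.assoc]
      _ = S.ιb' ≫ (S.legX S.tf₁ ≫ pullback.fst _ _) := (congrArg (S.ιb' ≫ ·) hF).symm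
      _ = (S.ιb' ≫ S.legX S.tf₁) ≫ pullback.fst _ _ := (Category.assoc _ _ _).symm
  · calc (S.legXf ≫ S.cT) ≫ pullback.snd _ _ = S.legXf ≫ (S.cT ≫ pullback.snd _ _) :=
          Category.assoc _ _ _
      _ = S.legXf ≫ S.πX := congrArg (S.legXf ≫ ·) S.cT_snd
      _ = S.ιb ≫ pullback.snd (Spec.map (σ₁ k K)) S.f := S.legXf_πX
      _ = S.ιb' ≫ (S.legX S.tf₁ ≫ pullback.snd _ _) := (congrArg (S.ιb' ≫ ·) hS).symm
      _ = (S.ιb' ≫ S.legX S.tf₁) ≫ pullback.snd _ _ := (Category.assoc _ _ _).symm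

/-- **`X'_f ⊆ X_{tf}` is an irreducible component.** [cite: DeJong1996, 4.5, p. 66] -/
theorem range_cT_mem : Set.range S.cT ∈ irreducibleComponents (S.XT : Type u) := by
  -- generic points
  have hcb : IsGenericPoint (S.ιb' (genericPoint S.Xb)) (Set.range S.ιb') := by
    have h := S.ιb'.isClosedEmbedding.closure_image_eq ({genericPoint S.Xb} : Set S.Xb)
    rw [Set.image_singleton, (genericPoint_spec S.Xb).def, Set.image_univ] at h
    exact h
  have h1 := closure_mem_irreducibleComponents_of_flat (S.legX S.tf₁) S.range_ιb_mem hcb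
  have h2 : S.legX S.tf₁ (S.ιb' (genericPoint S.Xb)) = S.cT (genericPoint S.Xf) := by
    haveI : IsDominant S.legXf := ⟨S.legXf.surjective.denseRange⟩
    have e3 := congrArg (fun φ : S.Xb ⟶ S.XT => φ (genericPoint S.Xb)) S.legXf_cT
    simp only [Scheme.Hom.comp_apply] at e3
    rw [genericPoint_eq_of_isDominant S.legXf] at e3
    exact e3.symm
  have h3 : closure {S.cT (genericPoint S.Xf)} = Set.range S.cT := by
    have h := S.cT.isClosedEmbedding.closure_image_eq ({genericPoint S.Xf} : Set S.Xf)
    rw [Set.image_singleton, (genericPoint_spec S.Xf).def, Set.image_univ] at h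
    exact h
  rwa [h2, h3] at h1

/-! ## The closed immersion `ι' : X'_f ↪ X ×_k Spec k₁` -/

/-- `X_{tf} ≅ (Spec k[tf] ≅ Spec k₁ → Spec k) ×_k X`. [folklore] -/
def i3 : S.XT ≅ pullback (S.sE ≫ Spec.map S.aK) S.f :=
  pullback.congrHom (by rw [S.sE_aK, S.ρf_b₀]; rfl) (rfl : S.XO.hom = S.f)

/-- `i3` over `X`. [folklore] -/
@[reassoc]
theorem i3_hom_snd : S.i3.hom ≫ pullback.snd (S.sE ≫ Spec.map S.aK) S.f =
    pullback.snd (Spec.map ((baseNat k K ∅).app S.tf₁.unop)) S.f := by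
  rw [i3, pullback.congrHom_hom]
  erw [pullback.lift_snd]
  exact Category.comp_id _

/-- `i3` over the base. [folklore] -/
@[reassoc]
theorem i3_hom_fst : S.i3.hom ≫ pullback.fst (S.sE ≫ Spec.map S.aK) S.f =
    pullback.fst (Spec.map ((baseNat k K ∅).app S.tf₁.unop)) S.f := by
  rw [i3, pullback.congrHom_hom]
  erw [pullback.lift_fst]
  exact Category.comp_id _

/-- `… ≅ Spec k[tf] ×_{Spec k₁} (Spec k₁ ×_k X)`. [folklore] -/
def i4 : pullback (S.sE ≫ Spec.map S.aK) S.f ≅ pullback S.sE (pullback.fst (Spec.map S.aK) S.f) :=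
  (pullbackRightPullbackFstIso (Spec.map S.aK) S.f S.sE).symm

/-- **The closed immersion `ι' : X'_f ↪ X ×_k Spec k₁`.** [cite: DeJong1996, 4.5, p. 66] -/
def ι' : S.Xf ⟶ pullback S.f (Spec.map S.aK) :=
  S.cT ≫ S.i3.hom ≫ S.i4.hom ≫ pullback.snd S.sE (pullback.fst (Spec.map S.aK) S.f) ≫
    (pullbackSymmetry (Spec.map S.aK) S.f).hom

/-- `ι'` is a closed immersion. [folklore] -/
instance isClosedImmersion_ι' : IsClosedImmersion S.ι' := by
  unfold ι'
  infer_instance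

/-- `ι'` over `X`: `ι' ≫ pr_X = πX`. [folklore] -/
@[reassoc]
theorem ι'_fst : S.ι' ≫ pullback.fst S.f (Spec.map S.aK) = S.πX := by
  calc S.ι' ≫ pullback.fst S.f (Spec.map S.aK)
      = S.cT ≫ S.i3.hom ≫ S.i4.hom ≫ pullback.snd S.sE (pullback.fst (Spec.map S.aK) S.f) ≫
          ((pullbackSymmetry (Spec.map S.aK) S.f).hom ≫ pullback.fst S.f (Spec.map S.aK)) := by
        simp only [ι', Category.assoc]
    _ = S.cT ≫ S.i3.hom ≫ (S.i4.hom ≫ pullback.snd S.sE (pullback.fst (Spec.map S.aK) S.f) ≫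
          pullback.snd (Spec.map S.aK) S.f) := by rw [pullbackSymmetry_hom_comp_fst]
    _ = S.cT ≫ (S.i3.hom ≫ pullback.snd (S.sE ≫ Spec.map S.aK) S.f) := by
        rw [i4, Iso.symm_hom, pullbackRightPullbackFstIso_inv_snd_snd]
    _ = S.cT ≫ pullback.snd (Spec.map ((baseNat k K ∅).app S.tf₁.unop)) S.f := by rw [S.i3_hom_snd]
    _ = S.πX := S.cT_snd

/-- `ι'` over `Spec k₁`: `ι' ≫ pr = (X'_f → Spec k(tf)) ≫ sE`. [folklore] -/
@[reassoc]
theorem ι'_snd : S.ι' ≫ pullback.snd S.f (Spec.map S.aK) = S.qX S.tf ≫ S.sE := by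
  have h1 : pullback.snd S.sE (pullback.fst (Spec.map S.aK) S.f) ≫ pullback.fst (Spec.map S.aK) S.f =
      pullback.fst S.sE (pullback.fst (Spec.map S.aK) S.f) ≫ S.sE := pullback.condition.symm
  calc S.ι' ≫ pullback.snd S.f (Spec.map S.aK)
      = S.cT ≫ S.i3.hom ≫ S.i4.hom ≫ pullback.snd S.sE (pullback.fst (Spec.map S.aK) S.f) ≫
          ((pullbackSymmetry (Spec.map S.aK) S.f).hom ≫ pullback.snd S.f (Spec.map S.aK)) := by
        simp only [ι', Category.assoc]
    _ = S.cT ≫ S.i3.hom ≫ S.i4.hom ≫ (pullback.snd S.sE (pullback.fst (Spec.map S.aK) S.f) ≫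
          pullback.fst (Spec.map S.aK) S.f) := by rw [pullbackSymmetry_hom_comp_snd]
    _ = S.cT ≫ S.i3.hom ≫ (S.i4.hom ≫ pullback.fst S.sE (pullback.fst (Spec.map S.aK) S.f) ≫
          S.sE) := by rw [h1]
    _ = S.cT ≫ ((S.i3.hom ≫ pullback.fst (S.sE ≫ Spec.map S.aK) S.f) ≫ S.sE) := by
        rw [i4, Iso.symm_hom, pullbackRightPullbackFstIso_inv_fst_assoc, Category.assoc]
    _ = (S.cT ≫ pullback.fst (Spec.map ((baseNat k K ∅).app S.tf₁.unop)) S.f) ≫ S.sE := by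
        rw [S.i3_hom_fst, Category.assoc]
    _ = S.qX S.tf ≫ S.sE := congrArg (· ≫ S.sE) S.cT_fst

/-- The image of `ι'` is an irreducible component of `X ×_k Spec k₁`. [cite: DeJong1996, 4.5, p. 66] -/
theorem range_ι'_mem : Set.range S.ι' ∈ irreducibleComponents (↑(pullback S.f (Spec.map S.aK)) : Type u) := by
  let e : S.XT ⟶ pullback S.f (Spec.map S.aK) :=
    S.i3.hom ≫ S.i4.hom ≫ pullback.snd S.sE (pullback.fst (Spec.map S.aK) S.f) ≫
      (pullbackSymmetry (Spec.map S.aK) S.f).hom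
  haveI : IsIso e := by
    change IsIso (S.i3.hom ≫ S.i4.hom ≫ pullback.snd S.sE _ ≫ (pullbackSymmetry _ _).hom)
    infer_instance
  have h1 : Set.range S.ι' = (Scheme.homeoOfIso (asIso e)) '' Set.range S.cT := by
    rw [← Set.range_comp]
    rfl
  rw [h1]
  exact image_mem_irreducibleComponents_of_homeomorph _ S.range_cT_mem

/-! ## The conclusion over `k₁` -/

/-- **De Jong 1996, 4.5 at the final stage**: the descended data solve Thm. 4.1 (generically
étale form) for `X'_f → Spec k₁` and `Z'_f`. [cite: DeJong1996, 4.5, p. 66] -/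
theorem conclusion : ConclusionGenericallyEtale (S.ι' ≫ pullback.snd S.f (Spec.map S.aK))
    ((S.ι' ≫ pullback.fst S.f (Spec.map S.aK)) ⁻¹' S.Z) := by
  refine ⟨S.Uf, S.Ef, S.φf, S.Uf.ι, S.gE, S.isAlteration_φf, inferInstance, inferInstance,
    S.isProjectiveOver_Ef, S.isRegular_Ef, ?_, ?_, S.isGenericallyEtale_φf⟩
  · rw [S.ι'_snd, S.φf_qX_assoc]
    rfl
  · rw [S.ι'_fst]
    exact S.isSNC_Bf

end Setup

/-! ## The discharge -/

/-- **De Jong 1996, 4.5 — the finite subextension**, discharged: the named fact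
`DeJong1996.FiniteSubextension45` holds. [cite: DeJong1996, 4.5, p. 66] -/
theorem _root_.Literature.AlgebraicGeometry.Resolution.DeJong1996.FiniteSubextension45_holds :
    DeJong1996.FiniteSubextension45.{u} := by
  intro k _ K _ _ _ X f _ _ _ _ Z hZ _ Xb ιb _ _ hcomp h
  obtain ⟨X₁, Xbar₁, φ₁, j₁, g, h₁, h₂, h₃, h₄, h₅, h₆, h₇, h₈⟩ := h
  obtain ⟨n, cbar, hcbar⟩ := h₄
  obtain ⟨W₁, hW₁, hW₁e⟩ := h₈
  haveI := h₂
  haveI := h₃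
  haveI := hcbar
  -- the data in Spec-first form
  haveI : Algebra.IsAlgebraic k K := IsAlgClosure.isAlgebraic
  let sym := pullbackSymmetry f (Spec.map (CommRingCat.ofHom (algebraMap k K)))
  have hsf : sym.hom ≫ pullback.fst (Spec.map (CommRingCat.ofHom (algebraMap k K))) f =
      pullback.snd f _ := pullbackSymmetry_hom_comp_fst _ _
  have hss : sym.hom ≫ pullback.snd (Spec.map (CommRingCat.ofHom (algebraMap k K))) f =
      pullback.fst f _ := pullbackSymmetry_hom_comp_snd _ _
  have hrange : Set.range (ιb ≫ sym.hom) ∈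
      irreducibleComponents (↑(pullback (Spec.map (CommRingCat.ofHom (algebraMap k K))) f) : Type u) := by
    have : Set.range (ιb ≫ sym.hom) = Scheme.homeoOfIso sym '' Set.range ιb := by
      rw [← Set.range_comp]; rfl
    rw [this]
    exact image_mem_irreducibleComponents_of_homeomorph _ hcomp
  have hw : j₁ ≫ g = φ₁ ≫ (ιb ≫ sym.hom) ≫
      pullback.fst (Spec.map (CommRingCat.ofHom (algebraMap k K))) f := by
    rw [h₆, Category.assoc, hsf]
  have hsnc : IsStrictNormalCrossingsDivisor Xbar₁ (j₁ '' (φ₁ ⁻¹'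
      (((ιb ≫ sym.hom) ≫ pullback.snd (Spec.map (CommRingCat.ofHom (algebraMap k K))) f) ⁻¹' Z)) ∪
        (Set.range j₁)ᶜ) := by
    have : (ιb ≫ sym.hom) ≫ pullback.snd (Spec.map (CommRingCat.ofHom (algebraMap k K))) f =
        ιb ≫ pullback.fst f _ := by
      rw [Category.assoc, hss]
    rw [this]
    exact h₇
  let S : Setup k K :=
    { X := X, f := f, Z := Z, isClosed_Z := hZ, Xb := Xb, ιb := ιb ≫ sym.hom,
      range_ιb_mem := hrange, X₁ := X₁, Xbar₁ := Xbar₁, φ₁ := φ₁, j₁ := j₁, g := g,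
      isAlteration_φ₁ := h₁, n := n, cbar := cbar, isRegular_Xbar₁ := h₅, w := hw, isSNC := hsnc,
      W₁ := W₁, dense_W₁ := hW₁, etale_W₁ := hW₁e }
  haveI hXf : IsIntegral S.Xf := S.isIntegral_Xf
  exact ⟨S.K₁, S.finiteDimensional_K₁, S.Xf, S.ι', hXf, inferInstance, S.range_ι'_mem,
    S.conclusion⟩

/-- **De Jong 1996, 4.5 (descent from `k̄` to `k`)**, discharged: the named fact
`DeJong1996Descent` holds — by `DeJong1996Descent.of_finiteSubextension45` and
`DeJong1996.FiniteSubextension45_holds`. [cite: DeJong1996, 4.5, p. 66] -/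
theorem _root_.Literature.AlgebraicGeometry.Resolution.DeJong1996Descent_holds :
    DeJong1996Descent.{u} :=
  DeJong1996Descent.of_finiteSubextension45 DeJong1996.FiniteSubextension45_holds



end DeJong1996.Descent45

end Literature.AlgebraicGeometry.Resolution

end
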